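import Mathlib
import HarnessLib
import Summits.HubbardSuperconductivity.HubbardSuperconductivity.Theorems.KLProgrammeKLRegimeEngineTowerLevStepLinkUniformFKlEng
import Summits.HubbardSuperconductivity.HubbardSuperconductivity.Theorems.KLProgrammeKLRegimeEngineTowerLevZUnitOfKitGuard

/-!
# Route `KLProgramme` — crux K3 ENGINE (stmt-HubbardSuperconductivity-20437 `KLRegimeEngineV17F2`), stub (b) v2, THE LEVELS PACKAGE (ℓ), located #17
# «(ℓ)-Z-THREAD»: THE Z-STEP OF THE TOKENISED TOWER AT THE k-FREE BLOCK BOUNDS — `Z^K_{Λ_{dk}} ≠ 0` and the LAW GUARD of «(ℓ)-LINK-UNIFORM-F» give `Z^K_{Λ_{d(k+1)}} ≠ 0`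
# (cell gate-hubbard-kl, seat hubbard-kl-k3c2-p3 g14; the sibling of `klTowerBLevF_succ_le_kitStep_of_bounds` asked by k3c3-p2 g16 / p4 g20 (KL STATUS 2026-08-29 l.≈10170/10184);
#  = §1's prefix of …TowerLevStepLinkUniformF ∘ k3c3-p2's `hubbardEffPartitionFnCT_klScale_block_succ_ne_zero_of_kitGuard` (p683682); E1 may rename or supersede)

In the tokenised floor-keyed tower (`towerBorn_le_law_tracks_of_profile_base_tok`, k3c3-p2 g16) the partition function `Z^K_{Λ_{dk}} ≠ 0` is the induction's own
invariant: the step `Zk k → (law guard at block k) → Zk (k+1)` must be supplied next to `hstep_tok`.  At the k-free bounds of «(ℓ)-LINK-UNIFORM-F» the law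
guard `Φ̄·towerV D τ̄ (W̄·Z̄^m·klTowerMuLevF … d k m) < 1` IS (identically, `hΦeq`) the re-truncation guard `2Φ_kit·V_kit < 1` of the oriented kit form at
`κ′ = κ̄/√8^{dk}`, `α′ = ᾱ·4^{dk}`, `τ = e⁶κ′²`, `Nt := Bm` (the graded floor array in product units), so half of it is KitF's guard and k3c3-p2's Z-unit lemma
applies:

* §1 **`towerZ_succ_of_bounds`** — one block `k ≥ 1`: `Z^K_{Λ_{dk}} ≠ 0`, the block's Gram/decay data under the two k-free bounds, `c̄r, c̄c > 0`, `card/2 ≤ D` and the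
  law guard ⊢ `Z^K_{Λ_{d(k+1)}} ≠ 0`;
* §2 **`towerZ_succ_of_blockBounds`** — the binders of `levLawF_hstep_of_blockBounds_tok` VERBATIM ⊢
  `∀ k, 1 ≤ k → k < Kb → Z^K_{Λ_{dk}} ≠ 0 → Φ·towerV D τ (fun m ↦ W·Z^m·klTowerMuLevF … d k m) < 1 → Z^K_{Λ_{d(k+1)}} ≠ 0` (p4 g20's `hZsucc` shape, zero glue);
* §3 **`towerZ_succ_klEng`** — the same on the flow frame `K_n` with the block data discharged by `linkDataF_klEng`.
Compositions of landed theorems; nothing about the model is asserted beyond them; nothing asserts (ℓ), any stub, K3 or superconductivity.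
References: BGM 2006 §2.8 (2.76)–(2.84), §3 (3.2)–(3.8) [cite: BenfattoGiulianiMastropietro2006].
-/

noncomputable section

namespace Summit.HubbardSuperconductivity.HubbardSuperconductivity.Theorems.EngineV8

set_option linter.dupNamespace false -- summit = problem name (single-conjunct summit), D-0017

open Classical
open Real Finset Literature.MathematicalPhysics.QuantumLattice Literature.Probability.LatticeModels GrassmannAlgebra
open Literature.MathematicalPhysics.QuantumLattice.FermiRG Literature.MathematicalPhysics.QuantumLattice.FermiRG.BGM2006Routing
open Summit.HubbardSuperconductivity.HubbardSuperconductivity.Theorems.KLProgrammeLegKernels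
open Summit.HubbardSuperconductivity.HubbardSuperconductivity.Theorems.KLRegimeSplit
open Summit.HubbardSuperconductivity.HubbardSuperconductivity.Theorems.KLRegimeWick
open Summit.HubbardSuperconductivity.HubbardSuperconductivity.Theorems.TwoPointAssembly
open Summit.HubbardSuperconductivity.HubbardSuperconductivity.Theorems.DispersionFlow

variable {L M : ℕ} [NeZero L] [NeZero M]

/-! ## §1 One block at the bounds -/

set_option maxHeartbeats 400000 in
/-- **THE Z-STEP AT THE k-FREE BOUNDS, ONE BLOCK.**  For `1 ≤ d`, `1 ≤ k`, `Z^K_{Λ_{dk}} ≠ 0`, the block's Gram constant `κ` with `κ²·8^{dk} ≤ κ̄²`, rows/cols `≤ α ≤ ᾱ·4^{dk}`,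
constants `c̄r, c̄c > 0`, `card/2 ≤ D`: the LAW guard `Φ̄·towerV D τ̄ (W̄·Z̄^m·klTowerMuLevF … d k m) < 1` of «(ℓ)-LINK-UNIFORM-F» implies `Z^K_{Λ_{d(k+1)}} ≠ 0`.
[cite: BenfattoGiulianiMastropietro2006, §2.8 (2.76)-(2.84), §3 (3.2)-(3.8)] -/
theorem towerZ_succ_of_bounds {β : ℝ} (hβ : 0 < β) (U μ : ℝ) (K : TrigPolyC4v) {d k : ℕ} (hd : 1 ≤ d) (hk : 1 ≤ k)
    (hZ : hubbardEffPartitionFnCT L M β U μ 0 K (klScale klE0 (d * k)) ≠ 0)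
    {κ κb : ℝ} (hκ : 0 < κ) (hκb : 0 < κb) (hκκb : κ ^ 2 * (8 : ℝ) ^ (d * k) ≤ κb ^ 2)
    (hGB : IsGramBoundedR ((sectorSubMatrix L M β (bgmFatMultiplier L M klE0 β (nambuXiCT L μ K) (d * k - 1))).transpose *
      hubbardCovSliceCT L M β μ 0 K (klScale klE0 (d * (k + 1))) (klScale klE0 (d * k)) *
        sectorSubMatrix L M β (bgmFatMultiplier L M klE0 β (nambuXiCT L μ K) (d * k - 1))) κ)
    {α αb : ℝ} (hαb : 0 < αb) (hααb : α ≤ αb * (4 : ℝ) ^ (d * k))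
    (hrow : ∀ X, ∑ Y, ‖((sectorSubMatrix L M β (bgmFatMultiplier L M klE0 β (nambuXiCT L μ K) (d * k - 1))).transpose *
        hubbardCovSliceCT L M β μ 0 K (klScale klE0 (d * (k + 1))) (klScale klE0 (d * k)) *
          sectorSubMatrix L M β (bgmFatMultiplier L M klE0 β (nambuXiCT L μ K) (d * k - 1))) X Y‖ ≤ α)
    (hcol : ∀ Y, ∑ X, ‖((sectorSubMatrix L M β (bgmFatMultiplier L M klE0 β (nambuXiCT L μ K) (d * k - 1))).transpose *
        hubbardCovSliceCT L M β μ 0 K (klScale klE0 (d * (k + 1))) (klScale klE0 (d * k)) *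
          sectorSubMatrix L M β (bgmFatMultiplier L M klE0 β (nambuXiCT L μ K) (d * k - 1))) X Y‖ ≤ α)
    {crb ccb : ℝ} (hcrb : 0 < crb) (hccb : 0 < ccb)
    {D : ℕ} (hD : Fintype.card (SpaceTimeIdx L M × SectorLeg (sectorCount (d * k - 1))) / 2 ≤ D)
    (hguard : 9 * αb * ccb / ((27 : ℝ) ^ 5 * exp 1 * κb ^ 2 * crb) *
      towerV D (exp 2 * κb ^ 2 / ccb ^ 2)
        (fun m => 64 * (27 : ℝ) ^ 4 * exp 2 * crb / ccb * (exp 4 * ccb ^ 2 * imagTimeWeight β M ^ 2 / 8) ^ m * klTowerMuLevF L M β U μ K d k m) < 1) :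
    hubbardEffPartitionFnCT L M β U μ 0 K (klScale klE0 (d * (k + 1))) ≠ 0 := by
  have hx : 0 < imagTimeWeight β M := imagTimeWeight_pos_of_pos (M := M) hβ
  have hJ₁ : 1 ≤ d * k := le_trans hd (Nat.le_mul_of_pos_right d hk)
  have h8 : (0 : ℝ) < (8 : ℝ) ^ (d * k) := by positivity
  have he4 : 0 < exp 4 := exp_pos 4
  have he4' : exp 4 = exp 2 ^ 2 := by rw [← Real.exp_nat_mul]; norm_num
  have he6' : exp 6 = exp 2 * exp 4 := by rw [← exp_add]; norm_num
  have he2' : exp 2 = exp 1 ^ 2 := by rw [← Real.exp_nat_mul]; norm_num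
  -- the Gram constant at the bound: `κ′ ≥ κ`, `κ′²·8^{dk} = κ̄²`
  obtain ⟨κ', hκ'0, hκκ', hκ'sq⟩ := exists_sqrt_scaled hκ hκb h8 hκκb
  have hGB' := TorusFourierL2.isGramBoundedR_of_le hGB hκ.le hκκ'
  -- the decay constant at the bound
  have hα'0 : 0 < αb * (4 : ℝ) ^ (d * k) := by positivity
  have hrow2 : ∀ X, ∑ Y, ‖((sectorSubMatrix L M β (bgmFatMultiplier L M klE0 β (nambuXiCT L μ K) (d * k - 1))).transpose *
      hubbardCovSliceCT L M β μ 0 K (klScale klE0 (d * (k + 1))) (klScale klE0 (d * k)) *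
        sectorSubMatrix L M β (bgmFatMultiplier L M klE0 β (nambuXiCT L μ K) (d * k - 1))) X Y‖ ≤ αb * (4 : ℝ) ^ (d * k) :=
    fun X => (hrow X).trans hααb
  have hcol2 : ∀ Y, ∑ X, ‖((sectorSubMatrix L M β (bgmFatMultiplier L M klE0 β (nambuXiCT L μ K) (d * k - 1))).transpose *
      hubbardCovSliceCT L M β μ 0 K (klScale klE0 (d * (k + 1))) (klScale klE0 (d * k)) *
        sectorSubMatrix L M β (bgmFatMultiplier L M klE0 β (nambuXiCT L μ K) (d * k - 1))) X Y‖ ≤ αb * (4 : ℝ) ^ (d * k) :=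
    fun Y => (hcol Y).trans hααb
  -- kit parameters `τ := e⁶κ′²`, `ψ := κ′⁻²`, `ρ := κ′`
  have hτ2 : (exp 2 * (κ' + κ')) ^ 2 ≤ exp 6 * κ' ^ 2 := by
    have hk2 : 0 ≤ κ' ^ 2 := sq_nonneg _
    calc (exp 2 * (κ' + κ')) ^ 2 = 4 * exp 4 * κ' ^ 2 := by rw [he4']; ring
      _ ≤ exp 2 * exp 4 * κ' ^ 2 := mul_le_mul_of_nonneg_right (mul_le_mul_of_nonneg_right four_le_exp_two he4.le) hk2
      _ = exp 6 * κ' ^ 2 := by rw [he6']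
  -- abbreviations: units, arrays, parameters
  set ε : ℝ := imagTimeWeight β M with hε
  set Kc : ℝ := ε * ((((2 : ℝ) ^ (5 * (d * k))))⁻¹ * (ε ^ 2)⁻¹) with hKc
  set u : ℝ := (8 : ℝ) ^ (d * k) * ε ^ 2 with hu
  set μd : ℕ → ℝ := fun m => 32 * ε / 27 * (1 / 8 : ℝ) ^ m * klTowerMuLevF L M β U μ K d k m with hμd
  set Φ : ℝ := exp 1 * (9 * (αb * (4 : ℝ) ^ (d * k))) / κ' ^ 2 with hΦ
  set W : ℝ := 64 * (27 : ℝ) ^ 4 * exp 2 * crb / ccb with hW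
  set Z : ℝ := exp 4 * ccb ^ 2 * ε ^ 2 / 8 with hZ'
  set τb : ℝ := exp 2 * κb ^ 2 / ccb ^ 2 with hτb
  set Φb : ℝ := 9 * αb * ccb / ((27 : ℝ) ^ 5 * exp 1 * κb ^ 2 * crb) with hΦb
  set C : ℝ := 4 * (27 : ℝ) ^ 5 * (exp 4 / 2 * crb) with hC
  set K₂ : ℝ := (ε * exp 2 * ccb)⁻¹ with hK₂
  set u₂ : ℝ := ε ^ 2 * exp 4 * ccb ^ 2 with hu₂
  have hμd0 : ∀ m, 0 ≤ μd m := fun m => by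
    have := klTowerMuLevF_nonneg (L := L) (M := M) hβ U μ K d k m
    simp only [hμd]; positivity
  have hΦ0 : 0 ≤ Φ := by positivity
  -- the graded floor array in product units (as a function)
  have hBmNc : (fun m : ℕ => imagTimeWeight β M * klTowerMuLevF L M β U μ K d k m * klLevUnitF β M 0 m (d * k - 1) / 27) =
      fun m : ℕ => Kc * (u ^ m * μd m) := towerBmF_eq_units hβ U μ K hJ₁
  have hNc0 : ∀ m, 0 ≤ (fun m : ℕ => Kc * (u ^ m * μd m)) m := fun m => by have := hμd0 m; positivity
  have hNc00 : (fun m : ℕ => Kc * (u ^ m * μd m)) 0 = 0 := by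
    simp only [hμd, klTowerMuLevF_degree_zero, mul_zero]
  have hNtB : ∀ m, imagTimeWeight β M * klTowerMeasLev L M β U μ K d k (2 * m) 0 ≤ (fun m : ℕ => Kc * (u ^ m * μd m)) m := fun m => by
    rw [← hBmNc]; exact imagTimeWeight_mul_klTowerMeasLev_zero_le_towerBmF hβ U μ K d k hZ m
  -- the final array in product units (as a function)
  have hμbar : (fun m : ℕ => W * Z ^ m * klTowerMuLevF L M β U μ K d k m) = fun m : ℕ => (C * K₂) * (u₂ ^ m * μd m) := by
    funext m
    simp only [hW, hZ', hC, hK₂, hu₂, hμd]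
    rw [he4']
    field_simp
    ring
  -- guard bookkeeping: `towerV` of the two arrays
  have hVNc : towerV D (exp 6 * κ' ^ 2) (fun m : ℕ => Kc * (u ^ m * μd m)) = Kc * towerV D (exp 6 * κ' ^ 2 * u) μd := towerV_units D _ Kc u μd
  have hVbar : towerV D τb (fun m : ℕ => W * Z ^ m * klTowerMuLevF L M β U μ K d k m) = (C * K₂) * towerV D (τb * u₂) μd := by
    rw [hμbar]; exact towerV_units D _ (C * K₂) u₂ μd
  -- the four parameter identities and the output constant
  have hτeq : τb * u₂ = exp 6 * κ' ^ 2 * u := by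
    simp only [hτb, hu₂, hu]; rw [← hκ'sq, he6']; field_simp
  have h32 : (2 : ℝ) ^ (5 * (d * k)) = (4 : ℝ) ^ (d * k) * (8 : ℝ) ^ (d * k) := by
    rw [← mul_pow, show (4 : ℝ) * 8 = 2 ^ 5 by norm_num, ← pow_mul]
  have hΦeq : Φb * (C * K₂) = 2 * Φ * Kc := by
    simp only [hΦb, hC, hK₂, hΦ, hKc]
    rw [h32, ← hκ'sq, he4', he2']
    field_simp
    ring
  -- the guards of the kit form and of the re-truncation, from the final guard
  have hguard2 : 2 * Φ * towerV D (exp 6 * κ' ^ 2) (fun m : ℕ => Kc * (u ^ m * μd m)) < 1 := by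
    have key : 2 * Φ * towerV D (exp 6 * κ' ^ 2) (fun m : ℕ => Kc * (u ^ m * μd m)) =
        Φb * towerV D τb (fun m : ℕ => W * Z ^ m * klTowerMuLevF L M β U μ K d k m) := by
      rw [hVNc, hVbar, hτeq]
      calc 2 * Φ * (Kc * towerV D (exp 6 * κ' ^ 2 * u) μd) = (2 * Φ * Kc) * towerV D (exp 6 * κ' ^ 2 * u) μd := by ring
        _ = (Φb * (C * K₂)) * towerV D (exp 6 * κ' ^ 2 * u) μd := by rw [hΦeq]
        _ = Φb * ((C * K₂) * towerV D (exp 6 * κ' ^ 2 * u) μd) := by ring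
    rw [key]; exact hguard
  have hguardkit : exp 1 * (9 * (αb * (4 : ℝ) ^ (d * k))) / κ' ^ 2 * towerV D (exp 6 * κ' ^ 2) (fun m : ℕ => Kc * (u ^ m * μd m)) < 1 := by
    have hV0 : 0 ≤ towerV D (exp 6 * κ' ^ 2) (fun m : ℕ => Kc * (u ^ m * μd m)) := towerV_nonneg (by positivity) hNc0
    have : Φ * towerV D (exp 6 * κ' ^ 2) (fun m : ℕ => Kc * (u ^ m * μd m)) ≤
        2 * Φ * towerV D (exp 6 * κ' ^ 2) (fun m : ℕ => Kc * (u ^ m * μd m)) := by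
      rw [mul_assoc]; exact le_mul_of_one_le_left (mul_nonneg hΦ0 hV0) one_le_two
    exact lt_of_le_of_lt this hguard2
  -- the Z-step at the kit guard (k3c3-p2 g16, #18's first consumer)
  exact hubbardEffPartitionFnCT_klScale_block_succ_ne_zero_of_kitGuard (L := L) (M := M) hβ U μ K hd hk hZ hκ'0 hGB' hα'0 hrow2 hcol2 hκ'0
    hNc0 hNc00 hNtB hD hτ2 hguardkit

/-! ## §2 The step of the tokenised induction, all blocks (p4 g20's `hZsucc` shape) -/

/-- **THE Z-STEP OF THE TOKENISED FLOOR-KEYED TOWER** («(ℓ)-Z-THREAD», #17): with the binders of `levLawF_hstep_of_blockBounds_tok` VERBATIM,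
`∀ k, 1 ≤ k → k < Kb → Z^K_{Λ_{dk}} ≠ 0 → Φ·towerV D τ (m ↦ W·Z^m·klTowerMuLevF … d k m) < 1 → Z^K_{Λ_{d(k+1)}} ≠ 0`.
[cite: BenfattoGiulianiMastropietro2006, §2.8 (2.76)-(2.84), §3 (3.2)-(3.8)] -/
theorem towerZ_succ_of_blockBounds {β : ℝ} (hβ : 0 < β) (U μ : ℝ) (K : TrigPolyC4v) {d : ℕ} (hd : 2 ≤ d) (Kb : ℕ)
    {κb αb crb ccb : ℝ} (hκb : 0 < κb) (hαb : 0 < αb) (hcrb : 0 < crb) (hccb : 0 < ccb)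
    (κ α : ℕ → ℝ) (hκ : ∀ k, 1 ≤ k → k < Kb → 0 < κ k) (hκκb : ∀ k, 1 ≤ k → k < Kb → κ k ^ 2 * (8 : ℝ) ^ (d * k) ≤ κb ^ 2)
    (hααb : ∀ k, 1 ≤ k → k < Kb → α k ≤ αb * (4 : ℝ) ^ (d * k))
    (hGB : ∀ k, 1 ≤ k → k < Kb → IsGramBoundedR ((sectorSubMatrix L M β (bgmFatMultiplier L M klE0 β (nambuXiCT L μ K) (d * k - 1))).transpose *
      hubbardCovSliceCT L M β μ 0 K (klScale klE0 (d * (k + 1))) (klScale klE0 (d * k)) *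
        sectorSubMatrix L M β (bgmFatMultiplier L M klE0 β (nambuXiCT L μ K) (d * k - 1))) (κ k))
    (hrow : ∀ k, 1 ≤ k → k < Kb → ∀ X, ∑ Y, ‖((sectorSubMatrix L M β (bgmFatMultiplier L M klE0 β (nambuXiCT L μ K) (d * k - 1))).transpose *
        hubbardCovSliceCT L M β μ 0 K (klScale klE0 (d * (k + 1))) (klScale klE0 (d * k)) *
          sectorSubMatrix L M β (bgmFatMultiplier L M klE0 β (nambuXiCT L μ K) (d * k - 1))) X Y‖ ≤ α k)
    (hcol : ∀ k, 1 ≤ k → k < Kb → ∀ Y, ∑ X, ‖((sectorSubMatrix L M β (bgmFatMultiplier L M klE0 β (nambuXiCT L μ K) (d * k - 1))).transpose *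
        hubbardCovSliceCT L M β μ 0 K (klScale klE0 (d * (k + 1))) (klScale klE0 (d * k)) *
          sectorSubMatrix L M β (bgmFatMultiplier L M klE0 β (nambuXiCT L μ K) (d * k - 1))) X Y‖ ≤ α k)
    (hrow' : ∀ k, 1 ≤ k → k < Kb → ∀ X'', ∑ X', ‖(sectorAnalysisMatrix L M β (klAnisoFamily L M β μ K klE0 (d * k)) *
        sectorSubMatrix L M β (bgmFatMultiplier L M klE0 β (nambuXiCT L μ K) (d * k - 1))) X'' X'‖ ≤ crb)
    (hcol' : ∀ k, 1 ≤ k → k < Kb → ∀ X', ∑ X'', ‖(sectorAnalysisMatrix L M β (klAnisoFamily L M β μ K klE0 (d * k)) *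
        sectorSubMatrix L M β (bgmFatMultiplier L M klE0 β (nambuXiCT L μ K) (d * k - 1))) X'' X'‖ ≤ ccb)
    {D : ℕ} (hD : ∀ k, 1 ≤ k → k < Kb → Fintype.card (SpaceTimeIdx L M × SectorLeg (sectorCount (d * k - 1))) / 2 ≤ D)
    {W Z σ τ ψ Φ : ℝ}
    (hW : W = 64 * (27 : ℝ) ^ 4 * exp 2 * crb / ccb) (hZ' : Z = exp 4 * ccb ^ 2 * imagTimeWeight β M ^ 2 / 8)
    (hσ : σ = κb ^ 2 / (exp 4 * ccb ^ 2)) (hτ : τ = exp 2 * κb ^ 2 / ccb ^ 2) (hψ : ψ = exp 4 * ccb ^ 2 / κb ^ 2)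
    (hΦ : Φ = 9 * αb * ccb / ((27 : ℝ) ^ 5 * exp 1 * κb ^ 2 * crb)) :
    ∀ k, 1 ≤ k → k < Kb → hubbardEffPartitionFnCT L M β U μ 0 K (klScale klE0 (d * k)) ≠ 0 →
      Φ * towerV D τ (fun m => W * Z ^ m * klTowerMuLevF L M β U μ K d k m) < 1 →
      hubbardEffPartitionFnCT L M β U μ 0 K (klScale klE0 (d * (k + 1))) ≠ 0 := by
  have _hσ := hσ; have _hψ := hψ; have _hr := hrow'; have _hc := hcol'
  subst hW hZ' hτ hΦ
  intro k hk1 hk hZk hguard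
  exact towerZ_succ_of_bounds hβ U μ K (by omega) hk1 hZk (hκ k hk1 hk) hκb (hκκb k hk1 hk) (hGB k hk1 hk) hαb (hααb k hk1 hk)
    (hrow k hk1 hk) (hcol k hk1 hk) hcrb hccb (hD k hk1 hk) hguard

/-! ## §3 The Z-step on the flow frame, block data from the model -/

/-- **THE Z-STEP OF THE TOKENISED FLOOR-KEYED TOWER ON THE FLOW FRAME `K_n`, BLOCK DATA DISCHARGED** (`linkDataF_klEng`): `∃ Cκ Cb CJ > 0` such that under the
v1 doors and an admissible history at scale `n`, for `2 ≤ d`, every `Kb` with `d·Kb ≤ n_β + 1`, `d·Kb ≤ n + d`, and `card/2 ≤ D`, with `κ̄ ᾱ c̄r c̄c` and then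
`W Z σ τ ψ Φ` pinned by equations: `∀ k, 1 ≤ k → k < Kb → Z^{K_n}_{Λ_{dk}} ≠ 0 → Φ·towerV D τ (m ↦ W·Z^m·klTowerMuLevF … d k m) < 1 → Z^{K_n}_{Λ_{d(k+1)}} ≠ 0`.
[cite: BenfattoGiulianiMastropietro2006, §2.8 (2.76)-(2.84), §3 (3.2)-(3.8)] -/
theorem towerZ_succ_klEng (d : ℕ) (R : RenConsts) (c'' : ℝ) (hc'' : 0 < c'') :
    ∃ Cκ Cb CJ : ℝ, 0 < Cκ ∧ 0 < Cb ∧ 0 < CJ ∧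
      ∀ (G : GeoConsts) (P : SplitConsts) (Q : EngConsts) (c : ℝ), P.WF → R.WF2 → 0 < c → c ≤ klEngC₃6 P R →
      ∀ μ ∈ klWindowC, ∀ U : ℝ, 0 < U → U ≤ klEngU₀9 P R c → c'' * U ≤ 1 →
      ∀ β : ℝ, klBetaMin ≤ β → β ≤ Real.exp (c / U ^ 2) →
      ∀ (L M : ℕ) [NeZero L] [NeZero M], klEngL₃ β U ≤ L → klEngM₃ β U L ≤ M →
      ∀ n : ℕ, 1 ≤ n → n ≤ nScales β + 1 → IsKLRegime U c (-(n : ℤ)) →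
        HistP klPredsV17F2 L M G P Q R β U μ 0 n → FrameOK R U (nScales β) μ (klFlowFrameU L M β U μ n) →
        (∀ m, 1 ≤ m → m < n → FlowPieceOscAt L M c'' β U μ m) →
      2 ≤ d → ∀ Kb : ℕ, d * Kb ≤ nScales β + 1 → d * Kb ≤ n + d →
      ∀ D : ℕ, (∀ k, 1 ≤ k → k < Kb → Fintype.card (SpaceTimeIdx L M × SectorLeg (sectorCount (d * k - 1))) / 2 ≤ D) →
      ∀ (κb αb crb ccb : ℝ), κb = Real.sqrt (2 * Cκ * klE0) → αb = Cb * ((M : ℝ) / β) * (4 : ℝ) ^ d / klE0 →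
        crb = 81 * CJ * M / β → ccb = 162 * CJ * M / β →
      ∀ (W Z σ τ ψ Φ : ℝ),
        W = 64 * (27 : ℝ) ^ 4 * exp 2 * crb / ccb → Z = exp 4 * ccb ^ 2 * imagTimeWeight β M ^ 2 / 8 →
        σ = κb ^ 2 / (exp 4 * ccb ^ 2) → τ = exp 2 * κb ^ 2 / ccb ^ 2 → ψ = exp 4 * ccb ^ 2 / κb ^ 2 →
        Φ = 9 * αb * ccb / ((27 : ℝ) ^ 5 * exp 1 * κb ^ 2 * crb) →
      ∀ k, 1 ≤ k → k < Kb → hubbardEffPartitionFnCT L M β U μ 0 (klFlowFrameU L M β U μ n) (klScale klE0 (d * k)) ≠ 0 →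
        Φ * towerV D τ (fun m => W * Z ^ m * klTowerMuLevF L M β U μ (klFlowFrameU L M β U μ n) d k m) < 1 →
        hubbardEffPartitionFnCT L M β U μ 0 (klFlowFrameU L M β U μ n) (klScale klE0 (d * (k + 1))) ≠ 0 := by
  obtain ⟨Cκ, Cb, CJ, hCκ, hCb, hCJ, hdata⟩ := linkDataF_klEng d R c'' hc''
  refine ⟨Cκ, Cb, CJ, hCκ, hCb, hCJ, ?_⟩
  intro G P Qe c hP hR2 hc hc6 μ hμ U hU hU9 hcU β hβmin hβc L M _ _ hL3 hM3 n hn1 hnN hreg hhist hfr hosc hd Kb hKbN hKbn D hD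
    κb αb crb ccb hκb hαb hcrb hccb W Z σ τ ψ Φ hW hZ' hσ hτ hψ hΦ
  have he : (0 : ℝ) < klE0 := by norm_num [klE0]
  have hβ : 0 < β := KLRegimeSplit.pos_of_klBetaMin_le hβmin
  have hM0 : (0 : ℝ) < M := Nat.cast_pos.2 (Nat.pos_of_ne_zero (NeZero.ne M))
  have hκb0 : 0 < κb := by rw [hκb]; exact Real.sqrt_pos.2 (by positivity)
  have hαb0 : 0 < αb := by rw [hαb]; positivity
  have hcrb0 : 0 < crb := by rw [hcrb]; positivity
  have hccb0 : 0 < ccb := by rw [hccb]; positivity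
  have hD' : ∀ k, 1 ≤ k → k < Kb → _ := fun k hk1 hk => by
    have hdk : 2 ≤ d * k := le_trans hd (Nat.le_mul_of_pos_right d hk1)
    have hkN : d * (k + 1) ≤ nScales β + 1 := le_trans (Nat.mul_le_mul_left d (by omega)) hKbN
    have h1 : d * k + d ≤ d * Kb := by rw [← Nat.mul_succ]; exact Nat.mul_le_mul_left d (by omega)
    exact hdata G P Qe c hP hR2 hc hc6 μ hμ U hU hU9 hcU β hβmin hβc L M hL3 hM3 n hn1 hnN hreg hhist hfr hosc k hk1 hdk hkN (by omega)
  exact towerZ_succ_of_blockBounds (L := L) (M := M) hβ U μ (klFlowFrameU L M β U μ n) hd Kb hκb0 hαb0 hcrb0 hccb0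
    (fun k => Real.sqrt (Cκ * (klScale klE0 (d * k) / klScale klE0 (d * k - 1)) * (klE0 * ((8 : ℝ) ^ (d * k - 1))⁻¹))) (fun k => Cb * ((M : ℝ) / β) / klScale klE0 (d * (k + 1)))
    (fun k hk1 hk => (hD' k hk1 hk).1) (fun k hk1 hk => by rw [hκb]; exact (hD' k hk1 hk).2.1)
    (fun k hk1 hk => by rw [hαb]; exact (hD' k hk1 hk).2.2.2.2.2.1) (fun k hk1 hk => (hD' k hk1 hk).2.2.1)
    (fun k hk1 hk => (hD' k hk1 hk).2.2.2.1) (fun k hk1 hk => (hD' k hk1 hk).2.2.2.2.1)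
    (fun k hk1 hk => by rw [hcrb]; exact (hD' k hk1 hk).2.2.2.2.2.2.1) (fun k hk1 hk => by rw [hccb]; exact (hD' k hk1 hk).2.2.2.2.2.2.2)
    hD hW hZ' hσ hτ hψ hΦ

end Summit.HubbardSuperconductivity.HubbardSuperconductivity.Theorems.EngineV8

end
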